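import Summits.QuantumFields.GaugeBoot.SOMasterLoopWordTraces
import Summits.QuantumFields.GaugeBoot.SOMasterLoopPairAlgebra
import HarnessLib

/-!
# The `𝔰𝔬(N)` contractions ARE Chatterjee's string operations: twistings, splittings, mergers (gauge-boot, ADDENDUM 27 part M4c)

HONEST FRAMING (cell `pub-gaugeboot`, page 1 of every file): the venture produces certified bounds
on lattice expectations at stated coupling, gauge group, dimension and torus size; NOT a mass gap,
NOT a continuum limit, NOT a string tension; NOT Yang–Mills-summit-bearing (barriers
`FixedCouplingUltralocality`, `PerturbativeInvisibility`).  Pointwise identities between functions of a configuration;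
nothing about a measure is claimed here.

## Content

Seventh file of the lane's programme on the tree's NAMED FACT `Chatterjee2019LargeN.UnsymmetrizedMasterLoopEquation`
(Chatterjee, CMP 366 (2019), Theorem 8.1).  Summing the trace formulas of part M4a over the antisymmetric units
`X_ij` (parts M1, M4b) produces EXACTLY the loop operations of `LatticeStrings` (§2.2 of the source), read through
`W = tr ∘ holC` (the `core` being invisible, `trace_holC_core`).  With `W_w(U) = tr holC_U(w)` and the marked undirected
link `ε`:

* ★ `sum_trace_ins2Prod_self` — a location `x` on `ε`: `Σ_ij tr(ins2Prod_{x,x}) = −2(N−1)·W_l` (the Casimir: the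
  coefficient `(N−1)m` of Theorem 8.1);
* ★ `sum_trace_ins2Prod_same` — `x ≠ y` carrying the SAME letter: `= 2(W(∝⁻_{x,y} l) − W(×¹_{x,y} l)·W(×²_{x,y} l))`
  (negative twisting, positive splitting);
* ★ `sum_trace_ins2Prod_inv` — `x, y` carrying INVERSE letters: `= 2(W(×¹)·W(×²) − W(∝⁺))` (negative splitting,
  positive twisting);
* ★ `sum_trace_insProd_mul_trace_insProd` — one location in each of two words: `= 2(W(l ⊖ l') − W(l ⊕ l'))` (mergers;
  with `l'` a plaquette word, deformations);
* `insProd_eq_zero_of_ne`, `ins2Prod_eq_zero_left/right` — locations off `ε` contribute nothing.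

References: S. Chatterjee, Comm. Math. Phys. 366 (2019) §2.2 (operations), §§6–8 (their derivation by Stein's method).
Everything is `[folklore]`.
-/

noncomputable section

open NormedSpace
open scoped Matrix.Norms.Frobenius Matrix
open Literature.MathematicalPhysics.QuantumLattice (LGConfig ZdEdge)
open Literature.MathematicalPhysics.QuantumFieldTheory (Chatterjee2019LargeN.Word)
open Literature.MathematicalPhysics.QuantumFieldTheory.Chatterjee2019LargeN
  (SO soRep DEdge core)
open Literature.MathematicalPhysics.QuantumFieldTheory.Chatterjee2019LargeN.Word
  (tailFrom arcBetween arcAfter letter posSplit₁ posSplit₂ negSplit₁ negSplit₂ negTwist posTwist posMergeRot negMergeRot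
   posMerge negMerge rotate_eq_letter_cons_drop)

namespace Summit.QuantumFields.GaugeBoot

namespace SOMasterLoop

variable {d N : ℕ} (ε : ZdEdge d) (U : LGConfig d (SO N)) (l : Chatterjee2019LargeN.Word d)

/-! ## Letters on and off the marked link -/

/-- A letter on `ε` is `(ε, true)` or `(ε, false)`. [folklore] -/
theorem eq_mk_of_fst_eq {a : DEdge d} (h : a.1 = ε) : a = (ε, a.2) := Prod.ext h rfl

/-- Off `ε` the insertion product vanishes. [folklore] -/
theorem insProd_eq_zero_of_ne (X : Matrix (Fin N) (Fin N) ℂ) {x : Fin l.length} (h : (l.get x).1 ≠ ε) :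
    insProd ε X l x U = 0 := by
  rw [insProd, insMat_of_ne ε X U h, prod_set_of_lt _ (by rw [List.length_map]; exact x.isLt), Matrix.mul_zero,
    Matrix.zero_mul]

/-- Off `ε` (first slot) the double-insertion product vanishes. [folklore] -/
theorem ins2Prod_eq_zero_left (X : Matrix (Fin N) (Fin N) ℂ) {x y : Fin l.length} (h : (l.get x).1 ≠ ε) :
    ins2Prod ε X l x y U = 0 := by
  by_cases hyx : y = x
  · subst hyx
    have hz : ins2Mat ε X U (l.get y) = 0 := by unfold ins2Mat; rw [if_neg h]
    rw [ins2Prod, if_pos rfl, List.set_set, prod_set_of_lt _ (by rw [List.length_map]; exact y.isLt), hz,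
      Matrix.mul_zero, Matrix.zero_mul]
  · rw [ins2Prod, if_neg hyx, List.set_comm _ _ (Fin.val_injective.ne (Ne.symm hyx)),
      prod_set_of_lt _ (by rw [List.length_set, List.length_map]; exact x.isLt), insMat_of_ne ε X U h,
      Matrix.mul_zero, Matrix.zero_mul]

/-- Off `ε` (second slot) the double-insertion product vanishes. [folklore] -/
theorem ins2Prod_eq_zero_right (X : Matrix (Fin N) (Fin N) ℂ) {x y : Fin l.length} (h : (l.get y).1 ≠ ε) :
    ins2Prod ε X l x y U = 0 := by
  by_cases hyx : y = x
  · subst hyx; exact ins2Prod_eq_zero_left ε U l X h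
  · rw [ins2Prod, if_neg hyx, prod_set_of_lt _ (by rw [List.length_set, List.length_map]; exact y.isLt),
      insMat_of_ne ε X U h, Matrix.mul_zero, Matrix.zero_mul]

/-- `l` rotated to `x` is its letter followed by the cyclic tail. [folklore] -/
theorem rotate_eq_get_cons_tailFrom (x : Fin l.length) : l.rotate x = l.get x :: tailFrom l x :=
  rotate_eq_letter_cons_drop l x

/-- `tr(letterMat_x · holC(tailFrom l x)) = W_l`. [folklore] -/
theorem trace_letterMat_mul_holC_tailFrom (x : Fin l.length) :
    (letterMat U (l.get x) * holC U (tailFrom l x)).trace = (holC U l).trace := by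
  rw [← holC_cons, ← rotate_eq_get_cons_tailFrom, trace_holC_rotate]

/-! ## The diagonal: the Casimir -/

/-- ★ **The Casimir slot**: for a location `x` on `ε`, `Σ_ij tr(ins2Prod_{x,x}) = −2(N−1)·W_l`. [folklore] -/
theorem sum_trace_ins2Prod_self {x : Fin l.length} (h : (l.get x).1 = ε) :
    ∑ i : Fin N, ∑ j : Fin N, (ins2Prod ε (soDir i j) l x x U).trace = -(2 * ((N : ℂ) - 1)) * (holC U l).trace := by
  have key := eq_mk_of_fst_eq ε h
  simp only [trace_ins2Prod_self]
  cases hb : (l.get x).2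
  · rw [hb] at key
    have e : ∀ i j : Fin N, ins2Mat ε (soDir i j : Matrix (Fin N) (Fin N) ℂ) U (l.get x) =
        letterMat U (l.get x) * soDir i j * soDir i j := by
      intro i j; rw [key]; simp [ins2Mat]
    simp only [e, sum_trace_bwd_bwd_same_slot, Fintype.card_fin, trace_letterMat_mul_holC_tailFrom]
  · rw [hb] at key
    have e : ∀ i j : Fin N, ins2Mat ε (soDir i j : Matrix (Fin N) (Fin N) ℂ) U (l.get x) =
        soDir i j * soDir i j * letterMat U (l.get x) := by
      intro i j; rw [key]; simp [ins2Mat]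
    simp only [e, sum_trace_fwd_fwd_same_slot, Fintype.card_fin, trace_letterMat_mul_holC_tailFrom]

/-! ## Two slots: twistings and splittings -/

/-- ★ **Same letter at `x ≠ y`**: `Σ_ij tr(ins2Prod_{x,y}) = 2(W(∝_{x,y} l) − W(×¹_{x,y} l)·W(×²_{x,y} l))` with the
NEGATIVE twisting and the POSITIVE splitting. [folklore] -/
theorem sum_trace_ins2Prod_same {x y : Fin l.length} (hxy : x ≠ y) (he : l.get y = l.get x) (h : (l.get x).1 = ε) :
    ∑ i : Fin N, ∑ j : Fin N, (ins2Prod ε (soDir i j) l x y U).trace =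
      2 * ((holC U (negTwist l x y)).trace - (holC U (posSplit₁ l x y)).trace * (holC U (posSplit₂ l x y)).trace) := by
  have key := eq_mk_of_fst_eq ε h
  simp only [trace_ins2Prod_of_ne ε _ U l hxy, he]
  have hT : (holC U (negTwist l x y)).trace = ((holC U (arcBetween l x y))ᵀ * holC U (arcAfter l x y)).trace := by
    rw [negTwist, trace_holC_core, holC_append, holC_invRev]
  have hS1 : (holC U (posSplit₁ l x y)).trace = (letterMat U (l.get x) * holC U (arcAfter l x y)).trace := by
    rw [posSplit₁, trace_holC_core, holC_cons, letter]
  have hS2 : (holC U (posSplit₂ l x y)).trace = (letterMat U (l.get x) * holC U (arcBetween l x y)).trace := by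
    rw [posSplit₂, trace_holC_core, trace_holC_append_comm, holC_append, holC_singleton, letter]
  rw [hT, hS1, hS2]
  cases hb : (l.get x).2
  · rw [hb] at key
    simp only [key, insMat_false]
    rw [sum_trace_pair_bwd_bwd _ _ _ (letterMat_mul_transpose_self U _), Matrix.trace_mul_comm (letterMat U _),
      Matrix.trace_mul_comm (letterMat U (ε, false))]
    ring
  · rw [hb] at key
    simp only [key, insMat_true]
    rw [sum_trace_pair_fwd_fwd _ _ _ (transpose_letterMat_mul_self U _)]
    ring

/-- ★ **Inverse letters at `x`, `y`**: `Σ_ij tr(ins2Prod_{x,y}) = 2(W(×¹_{x,y} l)·W(×²_{x,y} l) − W(∝_{x,y} l))` with the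
NEGATIVE splitting and the POSITIVE twisting. [folklore] -/
theorem sum_trace_ins2Prod_inv {x y : Fin l.length} (he : l.get y = DEdge.inv (l.get x)) (h : (l.get x).1 = ε) :
    ∑ i : Fin N, ∑ j : Fin N, (ins2Prod ε (soDir i j) l x y U).trace =
      2 * ((holC U (negSplit₁ l x y)).trace * (holC U (negSplit₂ l x y)).trace - (holC U (posTwist l x y)).trace) := by
  have hxy : x ≠ y := Literature.MathematicalPhysics.QuantumFieldTheory.Chatterjee2019LargeN.Word.ne_of_get_eq_inv he
  have key := eq_mk_of_fst_eq ε h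
  simp only [trace_ins2Prod_of_ne ε _ U l hxy, he]
  have hT : (holC U (posTwist l x y)).trace = (letterMat U (l.get x) * (holC U (arcBetween l x y))ᵀ *
      (letterMat U (l.get x))ᵀ * holC U (arcAfter l x y)).trace := by
    rw [posTwist, trace_holC_core, letter, holC_append, holC_cons, holC_cons, holC_invRev, letterMat_inv]
    simp only [Matrix.mul_assoc]
  have hS1 : (holC U (negSplit₁ l x y)).trace = (holC U (arcAfter l x y)).trace := by rw [negSplit₁, trace_holC_core]
  have hS2 : (holC U (negSplit₂ l x y)).trace = (holC U (arcBetween l x y)).trace := by rw [negSplit₂, trace_holC_core]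
  rw [hT, hS1, hS2]
  cases hb : (l.get x).2
  · rw [hb] at key
    have hinv : DEdge.inv (ε, false) = ((ε, true) : DEdge d) := rfl
    have hM : letterMat U (ε, true) = (letterMat U (ε, false))ᵀ := by rw [← letterMat_inv, hinv]
    simp only [key, hinv, insMat_false, insMat_true]
    rw [hM, sum_trace_pair_bwd_fwd _ _ _ (letterMat_mul_transpose_self U _)]
    ring
  · rw [hb] at key
    have hinv : DEdge.inv (ε, true) = ((ε, false) : DEdge d) := rfl
    have hM : letterMat U (ε, false) = (letterMat U (ε, true))ᵀ := by rw [← letterMat_inv, hinv]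
    simp only [key, hinv, insMat_false, insMat_true]
    rw [hM, sum_trace_pair_fwd_bwd _ _ _ (transpose_letterMat_mul_self U _)]
    ring

/-! ## Two words: mergers -/

/-- The merger traces in rotated form. [folklore] -/
theorem trace_negMergeRot_posMergeRot (a b : DEdge d) (t t' : Chatterjee2019LargeN.Word d) :
    (holC U (negMergeRot (a :: t) (b :: t'))).trace =
        (if b.2 = a.2 then (holC U t * (holC U t')ᵀ).trace else (holC U t * holC U t').trace) ∧
      (holC U (posMergeRot (a :: t) (b :: t'))).trace =
        (if b.2 = a.2 then (letterMat U a * holC U t * (letterMat U a * holC U t')).trace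
          else (letterMat U a * holC U t * (letterMat U a * (holC U t')ᵀ)).trace) := by
  constructor
  · rw [negMergeRot]
    split_ifs
    · rw [trace_holC_core, holC_append, holC_invRev, Matrix.trace_mul_comm]
    · rw [trace_holC_core, holC_append, Matrix.trace_mul_comm]
  · rw [posMergeRot]
    split_ifs
    · rw [trace_holC_core, holC_append, holC_cons, holC_cons]
      calc (letterMat U a * holC U t' * (letterMat U a * holC U t)).trace
          = ((letterMat U a * holC U t') * (letterMat U a * holC U t)).trace := by simp only [Matrix.mul_assoc]
        _ = ((letterMat U a * holC U t) * (letterMat U a * holC U t')).trace := Matrix.trace_mul_comm _ _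
        _ = _ := by simp only [Matrix.mul_assoc]
    · rw [trace_holC_core, holC_append, holC_cons, holC_cons, holC_invRev]
      calc (letterMat U a * (holC U t')ᵀ * (letterMat U a * holC U t)).trace
          = ((letterMat U a * (holC U t')ᵀ) * (letterMat U a * holC U t)).trace := by simp only [Matrix.mul_assoc]
        _ = ((letterMat U a * holC U t) * (letterMat U a * (holC U t')ᵀ)).trace := Matrix.trace_mul_comm _ _
        _ = _ := by simp only [Matrix.mul_assoc]

/-- ★ **Mergers**: for a location `x` of `l` and `y` of `m` on the same undirected link `ε`,
`Σ_ij tr(insProd_x(l))·tr(insProd_y(m)) = 2(W(l ⊖_{x,y} m) − W(l ⊕_{x,y} m))`. [folklore] -/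
theorem sum_trace_insProd_mul_trace_insProd (m : Chatterjee2019LargeN.Word d) {x : Fin l.length} {y : Fin m.length}
    (hx : (l.get x).1 = ε) (hy : (m.get y).1 = ε) :
    ∑ i : Fin N, ∑ j : Fin N, (insProd ε (soDir i j) l x U).trace * (insProd ε (soDir i j) m y U).trace =
      2 * ((holC U (negMerge l x m y)).trace - (holC U (posMerge l x m y)).trace) := by
  have kx := eq_mk_of_fst_eq ε hx
  have ky := eq_mk_of_fst_eq ε hy
  simp only [trace_insProd]
  rw [negMerge, posMerge, rotate_eq_get_cons_tailFrom, rotate_eq_get_cons_tailFrom]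
  obtain ⟨hneg, hpos⟩ := trace_negMergeRot_posMergeRot U (l.get x) (m.get y) (tailFrom l x) (tailFrom m y)
  rw [hneg, hpos]
  set T := holC U (tailFrom l x)
  set T' := holC U (tailFrom m y)
  cases hbx : (l.get x).2 <;> cases hby : (m.get y).2 <;> rw [hbx] at kx <;> rw [hby] at ky <;>
    simp only [kx, ky, insMat_true, insMat_false, if_true, if_false, Bool.false_eq_true, Bool.true_eq_false]
  · -- backward, backward
    rw [sum_trace_mul_trace_bwd_bwd _ _ _ (letterMat_mul_transpose_self U _)]
  · -- backward, forward
    have hM : letterMat U (ε, true) = (letterMat U (ε, false))ᵀ := by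
      rw [← letterMat_inv]; rfl
    rw [hM, sum_trace_mul_trace_bwd_fwd _ _ _ (letterMat_mul_transpose_self U _)]
  · -- forward, backward
    have hM : letterMat U (ε, false) = (letterMat U (ε, true))ᵀ := by
      rw [← letterMat_inv]; rfl
    rw [hM, sum_trace_mul_trace_fwd_bwd _ _ _ (transpose_letterMat_mul_self U _)]
  · -- forward, forward
    rw [sum_trace_mul_trace_fwd_fwd _ _ _ (transpose_letterMat_mul_self U _)]

end SOMasterLoop

end Summit.QuantumFields.GaugeBoot
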